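import Literature.Probability.Percolation.SitePercolationMeasure
import Literature.Probability.Percolation.SiteConnectionTools
import Literature.Probability.Percolation.CerfTwoArms
import Literature.Probability.Percolation.CerfTwoArmsProofs
import Literature.Probability.Percolation.CerfBoxLRO
import Literature.Probability.Percolation.CerfBoxLROProofs
import HarnessLib

/-!
# Cerf 2015, Lemma 7.1 (two-arms for distant sites): proof

Topic `Literature/Probability/Percolation`. Sorry-free discharge of the named fact
`Literature.Probability.Percolation.Cerf2015_lem_7_1` (`CerfTwoArms.lean`), and, combining it with
`Cerf2015_lem_10_1_holds` (`CerfTwoArmsProofs.lean`) and the assembly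
`Cerf2015_thm_1_3_of_facts` (`CerfBoxLROProofs.lean`), the reduction of Cerf's Theorem 1.3
(`Cerf2015_thm_1_3`, `Cerf2015_thm_1_3_three`, `CerfBoxLRO.lean`) to the single remaining input,
the two-arms exponent bound Theorem 1.1 in its `θ(p) > 0` form
(`Cerf2015_thm_1_1_of_siteTheta_pos`). R. Cerf, *A lower bound on the two-arms exponent for
critical percolation on the lattice*, Ann. Probab. 43 (2015) 2458–2480, doi:10.1214/14-AOP940,
arXiv:1306.3105, §7 (pp. 11–12 of the 16-page arXiv rendering).

## The statement (as vendored)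

For `d ≥ 2`, `0 < p < 1` there is `C = C(d, p)` (here `C = 3^{2d}/p`) such that for `n ≥ 1`,
`k + 2 ≤ ℓ`, `a, b ∈ Λ(n)`:
`P(two-arms(Λ(n), a, b, ℓ)) · P(a ⟷ b in Λ(n+k)) ≤ C (n+k)^{2d} P(two-arms(0, ℓ−k−1))`.

## The proof (Cerf 2015, §7, pp. 11–12), as formalised

Write `L = Λ(n+ℓ)`, `K = Λ(n+k)`, `C(a), C(b)` for the open clusters of `a, b` in `L`,
`Ā = A ∪ ∂ᵒᵘᵗA` for a set of sites `A`, and `m = ℓ − k − 1`.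
1. *Decoupling* (`P(C(a)=A, C(b)=B) P(a ⟷ b in K) ≤ P(C(a)=A, C(b)=B, E_{A,B})`). For a pair of
   finite sets `(A, B)` let `F_{A,B} = two-arms ∩ {C(a) = A, C(b) = B}` and
   `E_{A,B} = {ω : ω ∪ Ā ∪ B̄ ∈ {a ⟷ b in K}}` (the connection after opening `Ā ∪ B̄`; this
   replaces the paper's `{ΔA ⟷ ΔB in K ∖ (Ā ∪ B̄)}` and contains `{a ⟷ b in K}`). `F_{A,B}` is
   determined by the sites of `Ā ∪ B̄` (`determinedBy_twoArmsCylinder`) and `E_{A,B}` by those of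
   `K ∖ (Ā ∪ B̄)` (`determinedBy_union_mem_siteConnIn`), so they are independent under the
   product measure (`sitePercolation_real_inter_of_disjoint`), and summing over the partition
   `two-arms = ⨆_{(A,B)} F_{A,B}` gives
   `P(two-arms) P(a ⟷ b in K) ≤ P(⋃_{(A,B)} F_{A,B} ∩ E_{A,B})`.
2. *Surgery* (`twoArms_of_cylinder_conn`, the deterministic core). On `F_{A,B} ∩ E_{A,B}` follow
   the `(ω ∪ Ā ∪ B̄)`-open path from `a` to `b` in `K`: its last site `z` in `Ā` lies in
   `∂ᵒᵘᵗA ∩ K` (a closed site with a neighbour `y ∈ A`), the next site `u ∉ Ā`, and from `u` the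
   path runs through `ω`-open sites of `K ∖ (Ā ∪ B̄)` to a first site `v ∈ B̄ ∖ Ā`. Opening `v`
   (if it is not open already) joins `u` to `C(b)`, hence to `∂ⁱⁿL`, without touching `A`
   (the cluster of `a` is unchanged since `v ∉ Ā`), while `y` is joined to `∂ⁱⁿL` inside `A`.
   Restricting to the box `z + Λ(m) ⊆ L` (exit lemma) yields `two-arms(z, m)` for the
   configuration `ω ∪ {v}`, with `z, v ∈ K`. (The paper opens a neighbour `w ∈ ∂ᵒᵘᵗC(b)` of the
   endpoint of a `ΔA ⟷ ΔB` connection; this is the same surgery.)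
3. *Counting.* Hence `⋃ F ∩ E ⊆ ⋃_{z, v ∈ K} {ω : ω ∪ {v} ∈ two-arms(z, m)}`; opening one site
   costs a factor `1/p` (`real_preimage_insert_mul_le`), translation invariance gives
   `P(two-arms(z, m)) = P(two-arms(0, m))` (`real_siteTwoArms_le_zero`), and
   `|K|² = (2(n+k)+1)^{2d} ≤ 3^{2d} (n+k)^{2d}`.
The radius `m = ℓ − k − 1` (rather than the printed `ℓ − k`) is the one recorded in the vendored
statement (`CerfTwoArms.lean`, module docstring); with `z ∈ K` the radius `ℓ − k` would in fact
also do, but nothing downstream needs it.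

## Main results

* `Cerf2015_lem_7_1_holds : Cerf2015_lem_7_1`;
* `Cerf2015_thm_1_3_of_thm_1_1`, `Cerf2015_thm_1_3_three_of_thm_1_1`: Theorem 1.3 (general `d`,
  and the `d = 3`, `Λ(n^16)` form) from `Cerf2015_thm_1_1_of_siteTheta_pos` alone.

Tools of independent interest (all `[folklore]`): the path form of connection events
(`siteConnIn_iff_reflTransGen`), trapping / restriction / exit lemmas, cluster calculus for
`siteClusterIn`, the one-site surgery bound `p · P(ω ∪ {w} ∈ E) ≤ P(E)`, and the translation
invariance and locality of `siteTwoArms`.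

## References

* R. Cerf, Ann. Probab. 43 (2015) 2458–2480, arXiv:1306.3105, Lemma 7.1 (pp. 11–12).
* G. Grimmett, *Percolation*, 2nd ed., Springer 1999, §2.2 (local events, product structure).
-/

noncomputable section

namespace Literature.Probability.Percolation

open MeasureTheory

variable {V W : Type*}

/-! ### Connection events as chains of open sites -/

section PathTools

variable {G : SimpleGraph V}

/-- **Path form of `{x ⟷ y in S}`**: `ω ∈ {x ⟷ y in S}` iff `x` is an open site of `S` and `y` is
reached from `x` by a chain of `G`-adjacent open sites of `S`. [folklore] -/
theorem siteConnIn_iff_reflTransGen (S : Set V) (x y : V) (ω : SiteConfig V) :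
    ω ∈ siteConnIn G S x y ↔ x ∈ ω ∧ x ∈ S ∧
      Relation.ReflTransGen (fun u v => G.Adj u v ∧ u ∈ ω ∧ u ∈ S ∧ v ∈ ω ∧ v ∈ S) x y := by
  constructor
  · rintro ⟨hx, -, hxS, hyS, hr⟩
    refine ⟨hx, hxS, ?_⟩
    rw [SimpleGraph.reachable_iff_reflTransGen] at hr
    have key := Relation.ReflTransGen.lift (r := ((siteOpenGraph G ω).induce S).Adj)
      (p := fun u v => G.Adj u v ∧ u ∈ ω ∧ u ∈ S ∧ v ∈ ω ∧ v ∈ S) Subtype.val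
      (fun u v huv => by
        simp only [SimpleGraph.comap_adj, Function.Embedding.coe_subtype, siteOpenGraph_adj] at huv
        exact ⟨huv.1, huv.2.1, u.2, huv.2.2, v.2⟩)
    exact key _ _ hr
  · rintro ⟨hx, hxS, h⟩
    induction h with
    | refl => exact mem_siteConnIn_self G hx hxS
    | tail _ hbc ih =>
      exact siteConnIn_trans G subset_rfl subset_rfl ih
        (mem_siteConnIn_of_adj G hbc.2.1 hbc.2.2.2.1 hbc.2.2.1 hbc.2.2.2.2 hbc.1)

/-- **Trapping**: if `T ∋ x` is closed under passing to `G`-neighbours that are open sites of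
`S`, then every site joined to `x` in `S` lies in `T`. [folklore] -/
theorem mem_of_siteConnIn_of_forall_adj {S T : Set V} {ω : SiteConfig V}
    (hT : ∀ u ∈ T, ∀ v, G.Adj u v → v ∈ ω → v ∈ S → v ∈ T) {x y : V} (hx : x ∈ T)
    (h : ω ∈ siteConnIn G S x y) : y ∈ T := by
  obtain ⟨-, -, h'⟩ := (siteConnIn_iff_reflTransGen S x y ω).1 h
  clear h
  induction h' with
  | refl => exact hx
  | tail _ hbc ih => exact hT _ ih _ hbc.1 hbc.2.2.2.1 hbc.2.2.2.2

/-- **Restriction**: if every site joined to `x` in `S` lies in `T`, then `{x ⟷ y in S} ⊆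
{x ⟷ y in S ∩ T}` (an open path from `x` only visits sites joined to `x`). [folklore] -/
theorem siteConnIn_inter_of_forall {S T : Set V} {ω : SiteConfig V} {x y : V}
    (hT : ∀ w, ω ∈ siteConnIn G S x w → w ∈ T) (h : ω ∈ siteConnIn G S x y) :
    ω ∈ siteConnIn G (S ∩ T) x y := by
  obtain ⟨hx, hxS, h'⟩ := (siteConnIn_iff_reflTransGen S x y ω).1 h
  have hxT : x ∈ T := hT x (mem_siteConnIn_self G hx hxS)
  clear h
  induction h' with
  | refl => exact mem_siteConnIn_self G hx ⟨hxS, hxT⟩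
  | @tail b c hab hbc ih =>
    have hb : ω ∈ siteConnIn G S x b := (siteConnIn_iff_reflTransGen S x b ω).2 ⟨hx, hxS, hab⟩
    have hc : ω ∈ siteConnIn G S x c :=
      (siteConnIn_iff_reflTransGen S x c ω).2 ⟨hx, hxS, hab.tail hbc⟩
    exact siteConnIn_trans G subset_rfl subset_rfl ih
      (mem_siteConnIn_of_adj G hbc.2.1 hbc.2.2.2.1 ⟨hbc.2.2.1, hT _ hb⟩ ⟨hbc.2.2.2.2, hT _ hc⟩
        hbc.1)

variable [DecidableEq V] [G.LocallyFinite]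

/-- **Exit lemma** (relative form): for finite `Λ ⊆ L`, an open path in `L` from `x ∈ Λ` to a
site of `∂ⁱⁿL` meets `∂ⁱⁿΛ`, and does so first through open sites of `Λ`:
`{x ⟷ t in L} ⊆ ⋃_{w ∈ ∂ⁱⁿΛ} {x ⟷ w in Λ}` for `t ∈ ∂ⁱⁿL`. [folklore] -/
theorem exists_innerBoundary_siteConnIn_of_subset {Λ L : Finset V} (hΛL : Λ ⊆ L)
    {ω : SiteConfig V} {x t : V} (hx : x ∈ Λ) (ht : t ∈ LatticeModels.innerBoundary G L)
    (h : ω ∈ siteConnIn G ↑L x t) :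
    ∃ w ∈ LatticeModels.innerBoundary G Λ, ω ∈ siteConnIn G ↑Λ x w := by
  obtain ⟨hxω, -, h'⟩ := (siteConnIn_iff_reflTransGen (↑L) x t ω).1 h
  suffices H : ∀ u, Relation.ReflTransGen
      (fun u v => G.Adj u v ∧ u ∈ ω ∧ u ∈ (↑L : Set V) ∧ v ∈ ω ∧ v ∈ (↑L : Set V)) x u →
      (u ∈ Λ ∧ ω ∈ siteConnIn G ↑Λ x u) ∨ ∃ w ∈ LatticeModels.innerBoundary G Λ, ω ∈ siteConnIn G ↑Λ x w by
    rcases H t h' with ⟨htΛ, hxt⟩ | hdone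
    · refine ⟨t, ?_, hxt⟩
      rw [LatticeModels.mem_innerBoundary_iff] at ht ⊢
      obtain ⟨-, s, hs, hts⟩ := ht
      exact ⟨htΛ, s, fun h => hs (hΛL h), hts⟩
    · exact hdone
  intro u hu
  induction hu with
  | refl => exact Or.inl ⟨hx, mem_siteConnIn_self G hxω (Finset.mem_coe.2 hx)⟩
  | @tail b c _ hbc ih =>
    rcases ih with ⟨hbΛ, hxb⟩ | hdone
    · by_cases hcΛ : c ∈ Λ
      · exact Or.inl ⟨hcΛ, siteConnIn_trans G subset_rfl subset_rfl hxb
          (mem_siteConnIn_of_adj G hbc.2.1 hbc.2.2.2.1 (Finset.mem_coe.2 hbΛ)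
            (Finset.mem_coe.2 hcΛ) hbc.1)⟩
      · refine Or.inr ⟨b, ?_, hxb⟩
        rw [LatticeModels.mem_innerBoundary_iff]
        exact ⟨hbΛ, c, hcΛ, hbc.1⟩
    · exact Or.inr hdone

/-- Membership in the closure `A ∪ ∂ᵒᵘᵗA` of a finite set of sites: `x ∈ A` or `x` has a
neighbour in `A`. [folklore] -/
theorem mem_union_outerBoundary_iff {A : Finset V} {x : V} :
    x ∈ A ∪ LatticeModels.outerBoundary G A ↔ x ∈ A ∨ ∃ y ∈ A, G.Adj x y := by
  rw [Finset.mem_union, LatticeModels.mem_outerBoundary_iff]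
  by_cases hx : x ∈ A <;> simp [hx]

end PathTools

/-! ### One-site surgery: opening a site costs a factor `1/p` -/

section Surgery

/-- **One-site surgery bound**: for an event `E` determined by finitely many sites and any site
`w`, `p · P_p({ω : ω ∪ {w} ∈ E}) ≤ P_p(E)` (on `{w open}`, which is independent of
`{ω ∪ {w} ∈ E}` and has probability `p`, the two events agree). (Cerf 2015, p. 12: "we change
the status of `w` to open", the factor `1/p`.) [folklore] -/
theorem real_preimage_insert_mul_le [DecidableEq V] (p : unitInterval) {E : Set (SiteConfig V)}
    {F : Finset V} (hE : DeterminedBy E ↑F) (w : V) :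
    (sitePercolation V p).real {ω | insert w ω ∈ E} * p ≤ (sitePercolation V p).real E := by
  have hsub : {ω : SiteConfig V | insert w ω ∈ E} ∩ {ω | w ∈ ω} ⊆ E := by
    rintro ω ⟨h, hw⟩
    have h' : insert w ω ∈ E := h
    have hw' : w ∈ ω := hw
    rwa [Set.insert_eq_of_mem hw'] at h'
  have hdet1 : DeterminedBy {ω : SiteConfig V | insert w ω ∈ E} ↑(F.erase w) := by
    rw [determinedBy_iff]
    intro ω ω' h
    simp only [Set.mem_setOf_eq]
    refine (determinedBy_iff _ _).1 hE _ _ ?_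
    ext v
    have := Set.ext_iff.1 h v
    simp only [Set.mem_inter_iff, Set.mem_insert_iff, Finset.mem_coe, Finset.mem_erase] at this ⊢
    by_cases hvw : v = w
    · simp [hvw]
    · constructor
      · rintro ⟨h1 | hv, hvF⟩
        · exact absurd h1 hvw
        · exact ⟨Or.inr (this.1 ⟨hv, hvw, hvF⟩).1, hvF⟩
      · rintro ⟨h1 | hv, hvF⟩
        · exact absurd h1 hvw
        · exact ⟨Or.inr (this.2 ⟨hv, hvw, hvF⟩).1, hvF⟩
  have hdet2 : DeterminedBy {ω : SiteConfig V | w ∈ ω} ↑({w} : Finset V) := by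
    rw [determinedBy_iff]
    intro ω ω' h
    have := Set.ext_iff.1 h w
    simp only [Set.mem_inter_iff, Finset.coe_singleton, Set.mem_singleton_iff, and_true] at this
    exact this
  have hdisj : Disjoint (F.erase w) {w} := by simp
  calc (sitePercolation V p).real {ω | insert w ω ∈ E} * p
      = (sitePercolation V p).real ({ω | insert w ω ∈ E} ∩ {ω | w ∈ ω}) := by
        rw [sitePercolation_real_inter_of_disjoint p hdet1 hdet2 hdisj, sitePercolation_real_mem]
    _ ≤ (sitePercolation V p).real E := measureReal_mono hsub (measure_ne_top _ _)

/-- The event "`{a ⟷ b in K}` after opening all sites of `D`" is determined by the sites of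
`K ∖ D`. [folklore] -/
theorem determinedBy_union_mem_siteConnIn [DecidableEq V] {G : SimpleGraph V} (K D : Finset V)
    (a b : V) :
    DeterminedBy {ω : SiteConfig V | ω ∪ ↑D ∈ siteConnIn G ↑K a b} ↑(K \ D) := by
  rw [determinedBy_iff]
  intro ω ω' h
  simp only [Set.mem_setOf_eq]
  rw [mem_siteConnIn_iff_inter G ↑K a b (ω ∪ ↑D), mem_siteConnIn_iff_inter G ↑K a b (ω' ∪ ↑D)]
  suffices heq : (ω ∪ ↑D) ∩ ↑K = (ω' ∪ ↑D) ∩ ↑K by rw [heq]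
  ext v
  have := Set.ext_iff.1 h v
  simp only [Set.mem_inter_iff, Set.mem_union, Finset.mem_coe, Finset.mem_sdiff] at this ⊢
  by_cases hvD : v ∈ D
  · simp [hvD]
  · constructor
    · rintro ⟨hv | hv, hvK⟩
      · exact ⟨Or.inl ((this.1 ⟨hv, hvK, hvD⟩).1), hvK⟩
      · exact absurd hv hvD
    · rintro ⟨hv | hv, hvK⟩
      · exact ⟨Or.inl ((this.2 ⟨hv, hvK, hvD⟩).1), hvK⟩
      · exact absurd hv hvD

end Surgery

end Literature.Probability.Percolation

namespace Literature.Probability.Percolation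

section CritPerc

open MeasureTheory LatticeModels

variable {V W : Type*}

/-! ### Cluster calculus for `siteClusterIn` -/

section Cluster

variable {G : SimpleGraph V} {S : Set V} {ω : SiteConfig V} {x y w : V}

/-- Sites of a restricted cluster are open sites of the region. [folklore] -/
theorem mem_open_of_mem_siteClusterIn (h : y ∈ siteClusterIn G S ω x) : y ∈ ω ∧ y ∈ S := by
  obtain ⟨-, hy, -, hyS, -⟩ := h
  exact ⟨hy, hyS⟩

/-- A nonempty restricted cluster contains its root. [folklore] -/
theorem root_mem_siteClusterIn (h : y ∈ siteClusterIn G S ω x) : x ∈ siteClusterIn G S ω x := by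
  obtain ⟨hx, -, hxS, -, -⟩ := h
  exact (mem_siteClusterIn_self_iff G S ω x).2 ⟨hx, hxS⟩

/-- Restricted clusters are closed under passing to open neighbours inside the region. [folklore] -/
theorem mem_siteClusterIn_of_adj (h : y ∈ siteClusterIn G S ω x) (hyw : G.Adj y w) (hw : w ∈ ω)
    (hwS : w ∈ S) : w ∈ siteClusterIn G S ω x :=
  siteConnIn_trans G subset_rfl subset_rfl h
    (mem_siteConnIn_of_adj G (mem_open_of_mem_siteClusterIn h).1 hw
      (mem_open_of_mem_siteClusterIn h).2 hwS hyw)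

/-- Restricted clusters are closed under connection inside the region. [folklore] -/
theorem mem_siteClusterIn_of_siteConnIn (h : y ∈ siteClusterIn G S ω x)
    (h' : ω ∈ siteConnIn G S y w) : w ∈ siteClusterIn G S ω x :=
  siteConnIn_trans G subset_rfl subset_rfl h h'

/-- Two sites of the same restricted cluster are joined inside the region. [folklore] -/
theorem siteConnIn_of_mem_siteClusterIn (hy : y ∈ siteClusterIn G S ω x)
    (hw : w ∈ siteClusterIn G S ω x) : ω ∈ siteConnIn G S y w := by
  have hy' : ω ∈ siteConnIn G S y x := by rw [siteConnIn_comm]; exact hy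
  exact siteConnIn_trans G subset_rfl subset_rfl hy' hw

/-- Restricted clusters lie in the region. [folklore] -/
theorem siteClusterIn_subset (G : SimpleGraph V) (S : Set V) (ω : SiteConfig V) (x : V) :
    siteClusterIn G S ω x ⊆ S := fun _ h => (mem_open_of_mem_siteClusterIn h).2

/-- Restricted clusters grow with the configuration. [folklore] -/
theorem siteClusterIn_mono (G : SimpleGraph V) (S : Set V) {ω ω' : SiteConfig V} (h : ω ⊆ ω')
    (x : V) : siteClusterIn G S ω x ⊆ siteClusterIn G S ω' x :=
  fun y hy => siteConnIn_isUpperSet G S x y h hy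

/-- Restricted clusters only depend on the configuration inside the region. [folklore] -/
theorem siteClusterIn_eq_of_inter_eq (G : SimpleGraph V) {S : Set V} {ω ω' : SiteConfig V}
    (h : ω ∩ S = ω' ∩ S) (x : V) : siteClusterIn G S ω x = siteClusterIn G S ω' x := by
  ext y
  simp only [mem_siteClusterIn_iff]
  rw [mem_siteConnIn_iff_inter G S x y ω, mem_siteConnIn_iff_inter G S x y ω', h]

end Cluster

/-! ### The cylinder events `{C(a) = A, C(b) = B}` are determined by `Ā ∪ B̄` -/

section Cylinder

variable {G : SimpleGraph V} [DecidableEq V] [G.LocallyFinite]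

/-- If `C_L(a)(ω) = A ∋ a` and `ω'` agrees with `ω` on `A ∪ ∂ᵒᵘᵗA`, then `C_L(a)(ω') = A`.
(Cerf 2015, p. 11: "The event `{C(a) = A, C(b) = B}` depends only on the sites in `Ā ∪ B̄`".)
[cite: Cerf2015, §7 p. 11] -/
theorem siteClusterIn_eq_of_agree {L A : Finset V} {ω ω' : SiteConfig V} {a : V}
    (ha : a ∈ A) (hA : siteClusterIn G ↑L ω a = ↑A)
    (hag : ∀ v ∈ A ∪ outerBoundary G A, v ∈ ω ↔ v ∈ ω') :
    siteClusterIn G ↑L ω' a = ↑A := by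
  have hmem : ∀ {y}, y ∈ siteClusterIn G ↑L ω a ↔ y ∈ A := fun {y} => by
    rw [hA]; exact Finset.mem_coe
  ext x
  rw [Finset.mem_coe]
  constructor
  · intro hx
    have hT : ∀ u ∈ (↑A : Set V), ∀ v, G.Adj u v → v ∈ ω' → v ∈ (↑L : Set V) →
        v ∈ (↑A : Set V) := by
      intro u hu v huv hv hvL
      rw [Finset.mem_coe] at hu ⊢
      have hvcl : v ∈ A ∪ outerBoundary G A :=
        mem_union_outerBoundary_iff.2 (Or.inr ⟨u, hu, huv.symm⟩)
      have hvω : v ∈ ω := (hag v hvcl).2 hv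
      exact hmem.1 (mem_siteClusterIn_of_adj (hmem.2 hu) huv hvω hvL)
    exact mem_of_siteConnIn_of_forall_adj hT (Finset.mem_coe.2 ha) hx
  · intro hx
    have hωx : ω ∈ siteConnIn G ↑L a x := hmem.2 hx
    have h1 : ω ∈ siteConnIn G (↑L ∩ ↑A) a x :=
      siteConnIn_inter_of_forall (fun w hw => Finset.mem_coe.2 (hmem.1 hw)) hωx
    have h2 : ω' ∈ siteConnIn G (↑L ∩ ↑A) a x := by
      refine ((determinedBy_iff _ _).1 (determinedBy_siteConnIn G (↑L ∩ ↑A) a x) ω ω' ?_).1 h1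
      ext v
      simp only [Set.mem_inter_iff, Finset.mem_coe]
      constructor
      · rintro ⟨hv, hvL, hvA⟩
        exact ⟨(hag v (Finset.mem_union_left _ hvA)).1 hv, hvL, hvA⟩
      · rintro ⟨hv, hvL, hvA⟩
        exact ⟨(hag v (Finset.mem_union_left _ hvA)).2 hv, hvL, hvA⟩
    exact siteConnIn_mono_set G Set.inter_subset_left a x h2

/-- One direction of `determinedBy_twoArmsCylinder`: the event
`two-arms(L; a, b) ∩ {C_L(a) = A, C_L(b) = B}` passes from `ω` to any `ω'` agreeing with `ω` on
`Ā ∪ B̄`. [cite: Cerf2015, §7 p. 11] -/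
theorem twoArmsCylinder_of_agree {L A B : Finset V} {a b : V} {ω ω' : SiteConfig V}
    (hag : ∀ v ∈ A ∪ outerBoundary G A ∪ (B ∪ outerBoundary G B), v ∈ ω ↔ v ∈ ω')
    (hdisj : Disjoint (siteClusterIn G ↑L ω a) (siteClusterIn G ↑L ω b))
    (hbdA : ∃ w ∈ innerBoundary G L, w ∈ siteClusterIn G ↑L ω a)
    (hbdB : ∃ w ∈ innerBoundary G L, w ∈ siteClusterIn G ↑L ω b)
    (hA : siteClusterIn G ↑L ω a = ↑A) (hB : siteClusterIn G ↑L ω b = ↑B) :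
    (Disjoint (siteClusterIn G ↑L ω' a) (siteClusterIn G ↑L ω' b) ∧
        (∃ w ∈ innerBoundary G L, w ∈ siteClusterIn G ↑L ω' a) ∧
        (∃ w ∈ innerBoundary G L, w ∈ siteClusterIn G ↑L ω' b)) ∧
      siteClusterIn G ↑L ω' a = ↑A ∧ siteClusterIn G ↑L ω' b = ↑B := by
  have haA : a ∈ A := by
    obtain ⟨w, -, hw⟩ := hbdA
    have := root_mem_siteClusterIn hw
    rw [hA] at this
    exact this
  have hbB : b ∈ B := by
    obtain ⟨w, -, hw⟩ := hbdB
    have := root_mem_siteClusterIn hw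
    rw [hB] at this
    exact this
  have hA' : siteClusterIn G ↑L ω' a = ↑A :=
    siteClusterIn_eq_of_agree haA hA fun v hv => hag v (Finset.mem_union_left _ hv)
  have hB' : siteClusterIn G ↑L ω' b = ↑B :=
    siteClusterIn_eq_of_agree hbB hB fun v hv => hag v (Finset.mem_union_right _ hv)
  refine ⟨⟨?_, ?_, ?_⟩, hA', hB'⟩
  · rw [hA', hB']
    rw [hA, hB] at hdisj
    exact hdisj
  · rw [hA']
    rw [hA] at hbdA
    exact hbdA
  · rw [hB']
    rw [hB] at hbdB
    exact hbdB

/-- **Locality of the cylinder events** (Cerf 2015, p. 11): the event "the clusters of `a` and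
`b` in `L` are disjoint, both meet `∂ⁱⁿL`, and are exactly `A` and `B`" is determined by the
sites of `Ā ∪ B̄ = A ∪ ∂ᵒᵘᵗA ∪ B ∪ ∂ᵒᵘᵗB`. [cite: Cerf2015, §7 p. 11] -/
theorem determinedBy_twoArmsCylinder (L A B : Finset V) (a b : V) :
    DeterminedBy {ω : SiteConfig V |
      (Disjoint (siteClusterIn G ↑L ω a) (siteClusterIn G ↑L ω b) ∧
        (∃ w ∈ innerBoundary G L, w ∈ siteClusterIn G ↑L ω a) ∧
        (∃ w ∈ innerBoundary G L, w ∈ siteClusterIn G ↑L ω b)) ∧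
      siteClusterIn G ↑L ω a = ↑A ∧ siteClusterIn G ↑L ω b = ↑B}
      ↑(A ∪ outerBoundary G A ∪ (B ∪ outerBoundary G B)) := by
  rw [determinedBy_iff]
  intro ω ω' h
  have hag : ∀ v ∈ A ∪ outerBoundary G A ∪ (B ∪ outerBoundary G B), (v ∈ ω ↔ v ∈ ω') := by
    intro v hv
    have := Set.ext_iff.1 h v
    simp only [Set.mem_inter_iff, Finset.mem_coe] at this
    exact ⟨fun hω => (this.1 ⟨hω, hv⟩).1, fun hω' => (this.2 ⟨hω', hv⟩).1⟩
  simp only [Set.mem_setOf_eq]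
  constructor
  · rintro ⟨⟨h1, h2, h3⟩, h4, h5⟩
    exact twoArmsCylinder_of_agree hag h1 h2 h3 h4 h5
  · rintro ⟨⟨h1, h2, h3⟩, h4, h5⟩
    exact twoArmsCylinder_of_agree (fun v hv => (hag v hv).symm) h1 h2 h3 h4 h5

end Cylinder

/-! ### The deterministic core of Lemma 7.1: surgery producing a two-arms event -/

section Core

variable {G : SimpleGraph V} [DecidableEq V] [G.LocallyFinite]

/-- **The surgery of Cerf 2015, Lemma 7.1** (pp. 11–12), deterministic part. Let `K ⊆ L` be
finite, `C_L(a) = A`, `C_L(b) = B` disjoint clusters both meeting `∂ⁱⁿL`, and suppose that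
after opening every site of `Ā ∪ B̄` there is an open path from `a` to `b` inside `K`. Then
there are sites `z, v ∈ K` and neighbours `y, u` of `z` such that, in the configuration
`ω ∪ {v}`, the clusters of `y` and `u` inside the box `S z` are disjoint and both reach
`∂ⁱⁿ(S z)` — i.e. `two-arms` occurs at `z` — for any assignment `z ↦ S z ⊆ L` of boxes
containing the neighbours of their centre. (`z` = last site of the path in `Ā`, a closed site
of `∂ᵒᵘᵗA ∩ K`; `u` = the next site; `v` = the first site of `B̄` after `u`; `y ∈ A` a neighbour
of `z`.) [cite: Cerf2015, Lem 7.1 (proof, pp. 11–12)] -/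
theorem twoArms_of_cylinder_conn {K L : Finset V} (hKL : K ⊆ L) {a b : V} {ω : SiteConfig V}
    {A B : Finset V} (hA : siteClusterIn G ↑L ω a = ↑A) (hB : siteClusterIn G ↑L ω b = ↑B)
    (hdisj : Disjoint (siteClusterIn G ↑L ω a) (siteClusterIn G ↑L ω b))
    (hbdA : ∃ w ∈ innerBoundary G L, w ∈ siteClusterIn G ↑L ω a)
    (hbdB : ∃ w ∈ innerBoundary G L, w ∈ siteClusterIn G ↑L ω b)
    (hconn : ω ∪ ↑(A ∪ outerBoundary G A ∪ (B ∪ outerBoundary G B)) ∈ siteConnIn G ↑K a b)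
    (S : V → Finset V) (hS : ∀ z ∈ K, S z ⊆ L)
    (hSadj : ∀ z ∈ K, ∀ u, G.Adj z u → u ∈ S z) :
    ∃ z ∈ K, ∃ v ∈ K, ∃ y u : V, G.Adj z y ∧ G.Adj z u ∧
      Disjoint (siteClusterIn G ↑(S z) (insert v ω) y)
        (siteClusterIn G ↑(S z) (insert v ω) u) ∧
      (∃ w ∈ innerBoundary G (S z), w ∈ siteClusterIn G ↑(S z) (insert v ω) y) ∧
      (∃ w ∈ innerBoundary G (S z), w ∈ siteClusterIn G ↑(S z) (insert v ω) u) := by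
  -- membership in the clusters and in the closures `Ā = A ∪ ∂ᵒᵘᵗA`, `B̄`
  have hmA : ∀ {y}, y ∈ siteClusterIn G ↑L ω a ↔ y ∈ A := fun {y} => by
    rw [hA]; exact Finset.mem_coe
  have hmB : ∀ {y}, y ∈ siteClusterIn G ↑L ω b ↔ y ∈ B := fun {y} => by
    rw [hB]; exact Finset.mem_coe
  have hclA : ∀ {x}, x ∈ A ∪ outerBoundary G A ↔ x ∈ A ∨ ∃ y ∈ A, G.Adj x y := fun {x} =>
    mem_union_outerBoundary_iff
  have hclB : ∀ {x}, x ∈ B ∪ outerBoundary G B ↔ x ∈ B ∨ ∃ y ∈ B, G.Adj x y := fun {x} =>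
    mem_union_outerBoundary_iff
  have hAω : ∀ y ∈ A, y ∈ ω ∧ y ∈ L := fun y hy =>
    ⟨(mem_open_of_mem_siteClusterIn (hmA.2 hy)).1,
      Finset.mem_coe.1 (mem_open_of_mem_siteClusterIn (hmA.2 hy)).2⟩
  have hBω : ∀ y ∈ B, y ∈ ω ∧ y ∈ L := fun y hy =>
    ⟨(mem_open_of_mem_siteClusterIn (hmB.2 hy)).1,
      Finset.mem_coe.1 (mem_open_of_mem_siteClusterIn (hmB.2 hy)).2⟩
  have haA : a ∈ A := by
    obtain ⟨w, -, hw⟩ := hbdA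
    exact hmA.1 (root_mem_siteClusterIn hw)
  have hbB : b ∈ B := by
    obtain ⟨w, -, hw⟩ := hbdB
    exact hmB.1 (root_mem_siteClusterIn hw)
  -- clusters absorb their open neighbours in `L`
  have hc2A : ∀ y ∈ A, ∀ w, G.Adj y w → w ∈ ω → w ∈ L → w ∈ A := fun y hy w hyw hw hwL =>
    hmA.1 (mem_siteClusterIn_of_adj (hmA.2 hy) hyw hw (Finset.mem_coe.2 hwL))
  have hc2B : ∀ y ∈ B, ∀ w, G.Adj y w → w ∈ ω → w ∈ L → w ∈ B := fun y hy w hyw hw hwL =>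
    hmB.1 (mem_siteClusterIn_of_adj (hmB.2 hy) hyw hw (Finset.mem_coe.2 hwL))
  -- `B ∩ Ā = ∅`
  have hBcl : ∀ x ∈ B, x ∉ A ∪ outerBoundary G A := by
    intro x hxB hxcl
    rcases hclA.1 hxcl with hxA | ⟨y, hyA, hxy⟩
    · exact Set.disjoint_left.1 hdisj (hmA.2 hxA) (hmB.2 hxB)
    · exact Set.disjoint_left.1 hdisj
        (hmA.2 (hc2A y hyA x hxy.symm (hBω x hxB).1 (hBω x hxB).2)) (hmB.2 hxB)
  -- the open path after opening `Ā ∪ B̄`, as a chain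
  obtain ⟨haK, hbK, -⟩ := hconn.2.2
  obtain ⟨-, -, hpath⟩ := (siteConnIn_iff_reflTransGen _ a b _).1 hconn
  -- head induction along the chain: either the surgery data at the last exit from `Ā` is found
  -- further down the path, or the current site is outside `Ā` and runs to a first site of `B̄`
  have key : ∀ x, Relation.ReflTransGen (fun u v => G.Adj u v ∧
        u ∈ ω ∪ ↑(A ∪ outerBoundary G A ∪ (B ∪ outerBoundary G B)) ∧ u ∈ (↑K : Set V) ∧
        v ∈ ω ∪ ↑(A ∪ outerBoundary G A ∪ (B ∪ outerBoundary G B)) ∧ v ∈ (↑K : Set V)) x b →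
      (∃ z ∈ K, ∃ u ∈ K, G.Adj z u ∧ z ∈ A ∪ outerBoundary G A ∧
        u ∉ A ∪ outerBoundary G A ∧
        ∃ v ∈ K, v ∈ B ∪ outerBoundary G B ∧ v ∉ A ∪ outerBoundary G A ∧
          insert v ω ∈ siteConnIn G ↑K u v) ∨
      (x ∉ A ∪ outerBoundary G A ∧
        ∃ v ∈ K, v ∈ B ∪ outerBoundary G B ∧ v ∉ A ∪ outerBoundary G A ∧
          insert v ω ∈ siteConnIn G ↑K x v) := by
    intro x hx
    induction hx using Relation.ReflTransGen.head_induction_on with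
    | refl =>
      -- the endpoint `b`
      exact Or.inr ⟨hBcl b hbB, b, hbK, hclB.2 (Or.inl hbB), hBcl b hbB,
        mem_siteConnIn_self G (Set.mem_insert b ω) hbK⟩
    | @head x c hxc _ ih =>
      rcases ih with hgood | ⟨hccl, v, hvK, hvB, hvA, hcv⟩
      · exact Or.inl hgood
      · by_cases hxcl : x ∈ A ∪ outerBoundary G A
        · exact Or.inl ⟨x, hxc.2.2.1, c, hxc.2.2.2.2, hxc.1, hxcl, hccl, v, hvK, hvB, hvA, hcv⟩
        · refine Or.inr ⟨hxcl, ?_⟩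
          by_cases hxB : x ∈ B ∪ outerBoundary G B
          · exact ⟨x, hxc.2.2.1, hxB, hxcl, mem_siteConnIn_self G (Set.mem_insert x ω) hxc.2.2.1⟩
          · have hxω : x ∈ ω := by
              rcases hxc.2.1 with h | h
              · exact h
              · exfalso
                rw [Finset.mem_coe, Finset.mem_union] at h
                exact h.elim hxcl hxB
            refine ⟨v, hvK, hvB, hvA, ?_⟩
            exact siteConnIn_trans G subset_rfl subset_rfl
              (mem_siteConnIn_of_adj G (Set.mem_insert_of_mem v hxω) hcv.1 hxc.2.2.1
                hxc.2.2.2.2 hxc.1) hcv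
  -- `a ∈ A ⊆ Ā`, so the surgery data exist
  obtain ⟨z, hzK, u, huK, hzu, hzcl, hucl, v, hvK, hvB, hvA, huv⟩ :
      ∃ z ∈ K, ∃ u ∈ K, G.Adj z u ∧ z ∈ A ∪ outerBoundary G A ∧
        u ∉ A ∪ outerBoundary G A ∧
        ∃ v ∈ K, v ∈ B ∪ outerBoundary G B ∧ v ∉ A ∪ outerBoundary G A ∧
          insert v ω ∈ siteConnIn G ↑K u v := by
    rcases key a hpath with h | ⟨hacl, -⟩
    · exact h
    · exact absurd (hclA.2 (Or.inl haA)) hacl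
  -- `z ∈ ∂ᵒᵘᵗA`: a neighbour `y ∈ A`
  have hzA : z ∉ A := fun hz => hucl (hclA.2 (Or.inr ⟨z, hz, hzu.symm⟩))
  obtain ⟨y, hyA, hzy⟩ : ∃ y ∈ A, G.Adj z y := by
    rcases hclA.1 hzcl with hz | h
    · exact absurd hz hzA
    · exact h
  -- the modified configuration `ω ∪ {v}` and its cluster of `a` (still `A`, as `v ∉ Ā`)
  have hsubω : ω ⊆ insert v ω := Set.subset_insert v ω
  have htrap : ∀ x, insert v ω ∈ siteConnIn G ↑L a x → x ∈ A := by
    intro x hx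
    have hT : ∀ u' ∈ (↑A : Set V), ∀ w, G.Adj u' w → w ∈ insert v ω → w ∈ (↑L : Set V) →
        w ∈ (↑A : Set V) := by
      intro u' hu' w huw hw hwL
      rw [Finset.mem_coe] at hu' hwL ⊢
      rcases Set.mem_insert_iff.1 hw with rfl | hwω
      · exact absurd (hclA.2 (Or.inr ⟨u', hu', huw.symm⟩)) hvA
      · exact hc2A u' hu' w huw hwω hwL
    exact Finset.mem_coe.1 (mem_of_siteConnIn_of_forall_adj hT (Finset.mem_coe.2 haA) hx)
  have hSL : (↑(S z) : Set V) ⊆ ↑L := Finset.coe_subset.2 (hS z hzK)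
  have hKL' : (↑K : Set V) ⊆ ↑L := Finset.coe_subset.2 hKL
  -- exit points of the two clusters
  obtain ⟨xa, hxa, hxaA⟩ := hbdA
  obtain ⟨xb, hxb, hxbB⟩ := hbdB
  refine ⟨z, hzK, v, hvK, y, u, hzy, hzu, ?_, ?_, ?_⟩
  · -- disjointness: a common site would join `u` to `y ∈ A`, forcing `u ∈ A`
    refine Set.disjoint_left.2 fun x hxy hxu => hucl (hclA.2 (Or.inl ?_))
    have h1 : insert v ω ∈ siteConnIn G ↑L y u :=
      siteConnIn_trans G hSL hSL hxy (by rw [siteConnIn_comm]; exact hxu)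
    have h2 : insert v ω ∈ siteConnIn G ↑L a y :=
      siteConnIn_isUpperSet G _ _ _ hsubω (hmA.2 hyA)
    exact htrap u (siteConnIn_trans G subset_rfl subset_rfl h2 h1)
  · -- the arm of `y`: inside `A`, to `∂ⁱⁿL`, hence through `∂ⁱⁿ(S z)`
    have h1 : insert v ω ∈ siteConnIn G ↑L y xa :=
      siteConnIn_isUpperSet G _ _ _ hsubω (siteConnIn_of_mem_siteClusterIn (hmA.2 hyA) hxaA)
    exact exists_innerBoundary_siteConnIn_of_subset (hS z hzK) (hSadj z hzK y hzy) hxa h1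
  · -- the arm of `u`: to `v`, then (opening `v`) into `B`, to `∂ⁱⁿL`
    have h1 : insert v ω ∈ siteConnIn G ↑L u v := siteConnIn_mono_set G hKL' u v huv
    have h2 : insert v ω ∈ siteConnIn G ↑L v xb := by
      rcases hclB.1 hvB with hvB' | ⟨b', hb'B, hvb'⟩
      · exact siteConnIn_isUpperSet G _ _ _ hsubω
          (siteConnIn_of_mem_siteClusterIn (hmB.2 hvB') hxbB)
      · have h3 : insert v ω ∈ siteConnIn G ↑L v b' :=
          mem_siteConnIn_of_adj G (Set.mem_insert v ω) (hsubω (hBω b' hb'B).1) (hKL' hvK)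
            (Finset.mem_coe.2 (hBω b' hb'B).2) hvb'
        have h4 : insert v ω ∈ siteConnIn G ↑L b' xb :=
          siteConnIn_isUpperSet G _ _ _ hsubω
            (siteConnIn_of_mem_siteClusterIn (hmB.2 hb'B) hxbB)
        exact siteConnIn_trans G subset_rfl subset_rfl h3 h4
    exact exists_innerBoundary_siteConnIn_of_subset (hS z hzK) (hSadj z hzK u hzu) hxb
      (siteConnIn_trans G subset_rfl subset_rfl h1 h2)

end Core

/-! ### Locality and translation invariance of `two-arms(x, m)` -/

section TwoArmsEvent

variable {d : ℕ}

/-- `two-arms(x, m)` is determined by the sites of `x + Λ(m)`. [cite: Cerf2015, §5 p. 9] -/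
theorem determinedBy_siteTwoArms (x : Site d) (m : ℕ) :
    DeterminedBy (siteTwoArms d x m) ↑(shiftedBox x m) := by
  rw [determinedBy_iff]
  intro ω ω' h
  have hcl : ∀ y, siteClusterIn (zdGraph d) ↑(shiftedBox x m) ω y =
      siteClusterIn (zdGraph d) ↑(shiftedBox x m) ω' y :=
    fun y => siteClusterIn_eq_of_inter_eq (zdGraph d) h y
  simp only [siteTwoArms, Set.mem_setOf_eq, hcl]

/-- Translates of shifted boxes: `(· + v) '' (x + Λ(m)) = (x + v) + Λ(m)`. [folklore] -/
theorem image_zdShiftIso_shiftedBox (v x : Site d) (m : ℕ) :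
    (zdShiftIso v) '' (↑(shiftedBox x m) : Set (Site d)) = ↑(shiftedBox (x + v) m) := by
  ext t
  simp only [Set.mem_image, Finset.mem_coe, mem_shiftedBox_iff, zdShiftIso_apply]
  constructor
  · rintro ⟨s, hs, rfl⟩
    have : s + v - (x + v) = s - x := by abel
    rwa [this]
  · intro ht
    refine ⟨t - v, ?_, sub_add_cancel t v⟩
    have : t - v - x = t - (x + v) := by abel
    rwa [this]

/-- Under a graph isomorphism `φ`, the cluster of `φ x` in `φ '' S` for `φ '' ω` is the image
of the cluster of `x` in `S` for `ω`. [folklore] -/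
theorem siteClusterIn_relabel {G : SimpleGraph V} {G' : SimpleGraph W} (φ : G ≃g G') (S : Set V)
    (ω : SiteConfig V) (x : V) :
    siteClusterIn G' (φ '' S) (SiteConfig.relabel φ.toEquiv ω) (φ x) =
      φ '' siteClusterIn G S ω x := by
  ext t
  obtain ⟨s, rfl⟩ := φ.surjective t
  rw [mem_siteClusterIn_iff, relabel_mem_siteConnIn_iff, φ.injective.mem_set_image]
  rfl

/-- Graph isomorphisms map inner vertex boundaries to inner vertex boundaries. [folklore] -/
theorem map_mem_innerBoundary {G : SimpleGraph V} {G' : SimpleGraph W} [DecidableEq V]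
    [DecidableEq W] [G.LocallyFinite] [G'.LocallyFinite] (φ : G ≃g G') {S : Finset V}
    {S' : Finset W} (hS : (↑S' : Set W) = φ '' ↑S) {w : V} (hw : w ∈ innerBoundary G S) :
    φ w ∈ innerBoundary G' S' := by
  rw [mem_innerBoundary_iff] at hw ⊢
  obtain ⟨hwS, t, htS, hwt⟩ := hw
  refine ⟨?_, φ t, ?_, φ.map_rel_iff.2 hwt⟩
  · rw [← Finset.mem_coe, hS]
    exact Set.mem_image_of_mem _ hwS
  · rw [← Finset.mem_coe, hS, φ.injective.mem_set_image]
    exact htS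

/-- **Translation covariance of `two-arms(x, m)`**: `ω ∈ two-arms(x, m)` implies
`ω + v ∈ two-arms(x + v, m)`. [cite: Cerf2015, §5 p. 9] -/
theorem relabel_mem_siteTwoArms_shift {v x : Site d} {m : ℕ} {ω : SiteConfig (Site d)}
    (h : ω ∈ siteTwoArms d x m) :
    SiteConfig.relabel (zdShiftIso v).toEquiv ω ∈ siteTwoArms d (x + v) m := by
  obtain ⟨y, z, hy, hz, hdisj, ⟨w₁, hw₁, hw₁c⟩, ⟨w₂, hw₂, hw₂c⟩⟩ := h
  have hS := image_zdShiftIso_shiftedBox v x m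
  have hcl : ∀ t, siteClusterIn (zdGraph d) ↑(shiftedBox (x + v) m)
      (SiteConfig.relabel (zdShiftIso v).toEquiv ω) (zdShiftIso v t) =
      (zdShiftIso v) '' siteClusterIn (zdGraph d) ↑(shiftedBox x m) ω t := by
    intro t
    rw [← hS]
    exact siteClusterIn_relabel (zdShiftIso v) _ ω t
  refine ⟨zdShiftIso v y, zdShiftIso v z, ?_, ?_, ?_, ⟨zdShiftIso v w₁, ?_, ?_⟩,
    ⟨zdShiftIso v w₂, ?_, ?_⟩⟩
  · have := (zdShiftIso v).map_rel_iff.2 hy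
    exact this
  · have := (zdShiftIso v).map_rel_iff.2 hz
    exact this
  · rw [hcl, hcl]
    exact (Set.disjoint_image_iff (zdShiftIso v).injective).2 hdisj
  · exact map_mem_innerBoundary (zdShiftIso v) hS.symm hw₁
  · rw [hcl]
    exact Set.mem_image_of_mem _ hw₁c
  · exact map_mem_innerBoundary (zdShiftIso v) hS.symm hw₂
  · rw [hcl]
    exact Set.mem_image_of_mem _ hw₂c

/-- **Translation invariance**: `P_p(two-arms(z, m)) ≤ P_p(two-arms(0, m))` (in fact `=`; Cerf
2015, p. 12, "`P(two-arms(z, ℓ − k)) = P(two-arms(0, ℓ − k))`"). [cite: Cerf2015, Lem 7.1 (proof, p. 12)] -/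
theorem real_siteTwoArms_le_zero (p : unitInterval) (z : Site d) (m : ℕ) :
    (sitePercolation (Site d) p).real (siteTwoArms d z m) ≤
      (sitePercolation (Site d) p).real (siteTwoArms d 0 m) := by
  have hsub : siteTwoArms d z m ⊆
      SiteConfig.relabel (zdShiftIso (-z)).toEquiv ⁻¹' siteTwoArms d 0 m := by
    intro ω hω
    have := relabel_mem_siteTwoArms_shift (v := -z) hω
    rwa [add_neg_cancel] at this
  calc (sitePercolation (Site d) p).real (siteTwoArms d z m)
      ≤ (sitePercolation (Site d) p).real
          (SiteConfig.relabel (zdShiftIso (-z)).toEquiv ⁻¹' siteTwoArms d 0 m) :=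
        measureReal_mono hsub (measure_ne_top _ _)
    _ = (sitePercolation (Site d) p).real (siteTwoArms d 0 m) :=
        sitePercolation_real_preimage_relabel _ p _

/-- Shifted boxes centred in `Λ(N)` of radius `m` lie in `Λ(N + m)`. [folklore] -/
theorem shiftedBox_subset_box {N m : ℕ} {z : Site d} (hz : z ∈ box d N) :
    shiftedBox z m ⊆ box d (N + m) := by
  intro t ht
  rw [mem_shiftedBox_iff] at ht
  have h1 : t ∈ (box d m).image (· + z) := Finset.mem_image.2 ⟨t - z, ht, sub_add_cancel t z⟩
  exact image_add_box_subset hz h1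

/-- The neighbours of `z` lie in `z + Λ(m)` for `m ≥ 1`. [folklore] -/
theorem mem_shiftedBox_of_adj {m : ℕ} (hm : 1 ≤ m) {z u : Site d} (hzu : (zdGraph d).Adj z u) :
    u ∈ shiftedBox z m := by
  rw [mem_shiftedBox_iff, mem_box]
  rw [zdGraph_adj_iff] at hzu
  obtain ⟨i, h | h⟩ := hzu
  · have hu : u - z = Pi.single i 1 := by rw [h]; abel
    intro j
    rw [hu]
    by_cases hji : j = i
    · subst hji; simp; omega
    · simp [hji]
  · have hu : u - z = -Pi.single i 1 := by rw [h]; abel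
    intro j
    rw [hu]
    by_cases hji : j = i
    · subst hji; simp; omega
    · simp [hji]

end TwoArmsEvent

/-! ### Lemma 7.1 -/

/-- **Cerf 2015, Lemma 7.1, discharged** (two-arms for distant sites, pp. 11–12): for `d ≥ 2`,
`0 < p < 1`, with `C = 3^{2d}/p`, for all `n ≥ 1`, `k + 2 ≤ ℓ`, `a, b ∈ Λ(n)`,
`P(two-arms(Λ(n), a, b, ℓ)) · P(a ⟷ b in Λ(n+k)) ≤ C (n+k)^{2d} P(two-arms(0, ℓ−k−1))`.
Proof: decoupling over the cylinder events `{C(a) = A, C(b) = B}` (independence of events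
determined by disjoint sets of sites), the surgery `twoArms_of_cylinder_conn`, the one-site
cost `1/p`, translation invariance, and `|Λ(n+k)|² ≤ 3^{2d}(n+k)^{2d}`; see the module
docstring. The hypothesis `d ≥ 2` is not used. [cite: Cerf2015, Lem 7.1] -/
theorem Cerf2015_lem_7_1_holds : Cerf2015_lem_7_1 := by
  intro d _ p hp0 _
  refine ⟨(3 : ℝ) ^ (2 * d) / p, ?_⟩
  intro n hn k ℓ hkℓ a ha b hb
  classical
  -- boxes, radius, events
  set L : Finset (Site d) := box d (n + ℓ) with hL
  set K : Finset (Site d) := box d (n + k) with hK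
  set m : ℕ := ℓ - k - 1 with hm
  have hKL : K ⊆ L := box_mono d (by omega)
  have hnK : box d n ⊆ K := box_mono d (by omega)
  have hm1 : 1 ≤ m := by omega
  set μ := sitePercolation (Site d) p with hμ
  set Conn : Set (SiteConfig (Site d)) := siteConnIn (zdGraph d) ↑K a b with hConn
  set TA : Set (SiteConfig (Site d)) := siteTwoArmsPair d n a b ℓ with hTA
  have hTAmem : ∀ ω, ω ∈ TA ↔
      Disjoint (siteClusterIn (zdGraph d) ↑L ω a) (siteClusterIn (zdGraph d) ↑L ω b) ∧
        (∃ w ∈ innerBoundary (zdGraph d) L, w ∈ siteClusterIn (zdGraph d) ↑L ω a) ∧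
        (∃ w ∈ innerBoundary (zdGraph d) L, w ∈ siteClusterIn (zdGraph d) ↑L ω b) :=
    fun ω => Iff.rfl
  -- the partition of `TA` by the values of the two clusters
  set P : Finset (Finset (Site d) × Finset (Site d)) := L.powerset ×ˢ L.powerset with hP
  set F : Finset (Site d) × Finset (Site d) → Set (SiteConfig (Site d)) := fun x =>
    {ω | (Disjoint (siteClusterIn (zdGraph d) ↑L ω a) (siteClusterIn (zdGraph d) ↑L ω b) ∧
        (∃ w ∈ innerBoundary (zdGraph d) L, w ∈ siteClusterIn (zdGraph d) ↑L ω a) ∧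
        (∃ w ∈ innerBoundary (zdGraph d) L, w ∈ siteClusterIn (zdGraph d) ↑L ω b)) ∧
      siteClusterIn (zdGraph d) ↑L ω a = ↑x.1 ∧ siteClusterIn (zdGraph d) ↑L ω b = ↑x.2}
    with hF
  set D : Finset (Site d) × Finset (Site d) → Finset (Site d) := fun x =>
    x.1 ∪ outerBoundary (zdGraph d) x.1 ∪ (x.2 ∪ outerBoundary (zdGraph d) x.2) with hD
  set E : Finset (Site d) × Finset (Site d) → Set (SiteConfig (Site d)) := fun x =>
    {ω | ω ∪ ↑(D x) ∈ Conn} with hE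
  set Good : Set (SiteConfig (Site d)) :=
    ⋃ z ∈ K, ⋃ w ∈ K, {ω | insert w ω ∈ siteTwoArms d z m} with hGood
  have hTAeq : TA = ⋃ x ∈ P, F x := by
    ext ω
    simp only [Set.mem_iUnion, exists_prop]
    constructor
    · intro hω
      have hfinA : (siteClusterIn (zdGraph d) ↑L ω a).Finite :=
        L.finite_toSet.subset (siteClusterIn_subset _ _ _ _)
      have hfinB : (siteClusterIn (zdGraph d) ↑L ω b).Finite :=
        L.finite_toSet.subset (siteClusterIn_subset _ _ _ _)
      refine ⟨(hfinA.toFinset, hfinB.toFinset), ?_, (hTAmem ω).1 hω, ?_, ?_⟩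
      · simp only [hP, Finset.mem_product, Finset.mem_powerset]
        exact ⟨fun y hy => siteClusterIn_subset _ _ _ _ (hfinA.mem_toFinset.1 hy),
          fun y hy => siteClusterIn_subset _ _ _ _ (hfinB.mem_toFinset.1 hy)⟩
      · exact hfinA.coe_toFinset.symm
      · exact hfinB.coe_toFinset.symm
    · rintro ⟨x, -, hω, -, -⟩
      exact (hTAmem ω).2 hω
  have hFdisj : (↑P : Set (Finset (Site d) × Finset (Site d))).PairwiseDisjoint F := by
    intro x _ y _ hxy
    rw [Function.onFun, Set.disjoint_left]
    rintro ω ⟨-, h1, h2⟩ ⟨-, h1', h2'⟩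
    exact hxy (Prod.ext (Finset.coe_injective (h1.symm.trans h1'))
      (Finset.coe_injective (h2.symm.trans h2')))
  have hFdet : ∀ x, DeterminedBy (F x) ↑(D x) := fun x =>
    determinedBy_twoArmsCylinder L x.1 x.2 a b
  have hFmeas : ∀ x ∈ P, MeasurableSet (F x) := fun x _ => (hFdet x).measurableSet_of_finset
  have hEdet : ∀ x, DeterminedBy (E x) ↑(K \ D x) := fun x =>
    determinedBy_union_mem_siteConnIn K (D x) a b
  have hConnE : ∀ x, Conn ⊆ E x := fun x ω hω =>
    siteConnIn_isUpperSet (zdGraph d) _ _ _ Set.subset_union_left hω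
  -- decoupling, term by term
  have hstep : ∀ x ∈ P, μ.real (F x) * μ.real Conn ≤ μ.real (F x ∩ E x) := by
    intro x _
    rw [sitePercolation_real_inter_of_disjoint p (hFdet x) (hEdet x) Finset.disjoint_sdiff]
    exact mul_le_mul_of_nonneg_left (measureReal_mono (hConnE x) (measure_ne_top _ _))
      measureReal_nonneg
  have hFEdisj : (↑P : Set (Finset (Site d) × Finset (Site d))).PairwiseDisjoint
      fun x => F x ∩ E x :=
    hFdisj.mono fun x => Set.inter_subset_left
  have hFEmeas : ∀ x ∈ P, MeasurableSet (F x ∩ E x) := fun x hx =>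
    (hFmeas x hx).inter (hEdet x).measurableSet_of_finset
  -- the surgery
  have hcore : (⋃ x ∈ P, F x ∩ E x) ⊆ Good := by
    intro ω hω
    simp only [Set.mem_iUnion, exists_prop] at hω
    obtain ⟨⟨A, B⟩, -, ⟨⟨hdj, hbdA, hbdB⟩, hA, hB⟩, hEω⟩ := hω
    have hS : ∀ z ∈ K, shiftedBox z m ⊆ L := by
      intro z hz
      have h1 : n + k + m ≤ n + ℓ := by omega
      exact (shiftedBox_subset_box hz).trans (box_mono d h1)
    have hSadj : ∀ z ∈ K, ∀ u, (zdGraph d).Adj z u → u ∈ shiftedBox z m :=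
      fun z _ u hzu => mem_shiftedBox_of_adj hm1 hzu
    obtain ⟨z, hzK, v, hvK, y, u, h1, h2, h3, h4, h5⟩ :=
      twoArms_of_cylinder_conn hKL hA hB hdj hbdA hbdB hEω (fun z => shiftedBox z m) hS hSadj
    simp only [hGood, Set.mem_iUnion, exists_prop]
    exact ⟨z, hzK, v, hvK, y, u, h1, h2, h3, h4, h5⟩
  -- counting
  have hGood_le : μ.real Good ≤
      (K.card : ℝ) * ((K.card : ℝ) * (μ.real (siteTwoArms d 0 m) / p)) := by
    calc μ.real Good
        ≤ ∑ z ∈ K, μ.real (⋃ w ∈ K, {ω | insert w ω ∈ siteTwoArms d z m}) :=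
          measureReal_biUnion_finset_le _ _
      _ ≤ ∑ z ∈ K, ∑ w ∈ K, μ.real {ω | insert w ω ∈ siteTwoArms d z m} :=
          Finset.sum_le_sum fun z _ => measureReal_biUnion_finset_le _ _
      _ ≤ ∑ z ∈ K, ∑ w ∈ K, μ.real (siteTwoArms d 0 m) / p := by
          refine Finset.sum_le_sum fun z _ => Finset.sum_le_sum fun w _ => ?_
          rw [le_div_iff₀ hp0]
          exact (real_preimage_insert_mul_le p (determinedBy_siteTwoArms z m) w).trans
            (real_siteTwoArms_le_zero p z m)
      _ = (K.card : ℝ) * ((K.card : ℝ) * (μ.real (siteTwoArms d 0 m) / p)) := by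
          rw [Finset.sum_const, Finset.sum_const, nsmul_eq_mul, nsmul_eq_mul]
  have hchain : μ.real TA * μ.real Conn ≤ μ.real Good := by
    calc μ.real TA * μ.real Conn
        = (∑ x ∈ P, μ.real (F x)) * μ.real Conn := by
          rw [hTAeq, measureReal_biUnion_finset hFdisj hFmeas]
      _ = ∑ x ∈ P, μ.real (F x) * μ.real Conn := Finset.sum_mul _ _ _
      _ ≤ ∑ x ∈ P, μ.real (F x ∩ E x) := Finset.sum_le_sum hstep
      _ = μ.real (⋃ x ∈ P, F x ∩ E x) := (measureReal_biUnion_finset hFEdisj hFEmeas).symm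
      _ ≤ μ.real Good := measureReal_mono hcore (measure_ne_top _ _)
  -- `|K|² ≤ 3^{2d} (n+k)^{2d}`
  have hcard : (K.card : ℝ) ≤ (3 : ℝ) ^ d * ((n : ℝ) + k) ^ d := by
    have h1 : K.card = (2 * (n + k) + 1) ^ d := card_box d (n + k)
    have h2 : (2 * (n + k) + 1) ^ d ≤ (3 * (n + k)) ^ d :=
      Nat.pow_le_pow_left (by omega) d
    calc (K.card : ℝ) = ((2 * (n + k) + 1) ^ d : ℕ) := by rw [h1]
      _ ≤ ((3 * (n + k)) ^ d : ℕ) := by exact_mod_cast h2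
      _ = (3 : ℝ) ^ d * ((n : ℝ) + k) ^ d := by
          rw [Nat.cast_pow, Nat.cast_mul, mul_pow]; push_cast; ring
  have hK0 : (0 : ℝ) ≤ K.card := Nat.cast_nonneg _
  have hcard2 : (K.card : ℝ) * K.card ≤ (3 : ℝ) ^ (2 * d) * ((n : ℝ) + k) ^ (2 * d) := by
    calc (K.card : ℝ) * K.card
        ≤ ((3 : ℝ) ^ d * ((n : ℝ) + k) ^ d) * ((3 : ℝ) ^ d * ((n : ℝ) + k) ^ d) :=
          mul_le_mul hcard hcard hK0 (hK0.trans hcard)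
      _ = ((3 : ℝ) ^ d) ^ 2 * (((n : ℝ) + k) ^ d) ^ 2 := by ring
      _ = (3 : ℝ) ^ (2 * d) * ((n : ℝ) + k) ^ (2 * d) := by
          rw [← pow_mul, ← pow_mul, mul_comm d 2]
  have hμ0 : 0 ≤ μ.real (siteTwoArms d 0 m) := measureReal_nonneg
  calc μ.real TA * μ.real Conn ≤ μ.real Good := hchain
    _ ≤ (K.card : ℝ) * ((K.card : ℝ) * (μ.real (siteTwoArms d 0 m) / p)) := hGood_le
    _ = (K.card : ℝ) * K.card * μ.real (siteTwoArms d 0 m) / p := by ring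
    _ ≤ (3 : ℝ) ^ (2 * d) * ((n : ℝ) + k) ^ (2 * d) * μ.real (siteTwoArms d 0 m) / p :=
        div_le_div_of_nonneg_right (mul_le_mul_of_nonneg_right hcard2 hμ0) hp0.le
    _ = (3 : ℝ) ^ (2 * d) / p * ((n : ℝ) + k) ^ (2 * d) * μ.real (siteTwoArms d 0 m) := by ring

/-! ### Theorem 1.3 from Theorem 1.1 alone -/

/-- **Cerf 2015, Theorem 1.3 from Theorem 1.1 only**: with Lemma 7.1 (`Cerf2015_lem_7_1_holds`)
and Lemma 10.1 (`Cerf2015_lem_10_1_holds`) proved, the assembly `Cerf2015_thm_1_3_of_facts`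
(§10, p. 15) leaves the two-arms exponent bound Theorem 1.1 (in its `θ(p) > 0` form) as the
only input. [cite: Cerf2015, Thm 1.3 and §10] -/
theorem Cerf2015_thm_1_3_of_thm_1_1 (h11 : Cerf2015_thm_1_1_of_siteTheta_pos) :
    Cerf2015_thm_1_3 :=
  Cerf2015_thm_1_3_of_facts Cerf2015_lem_7_1_holds Cerf2015_lem_10_1_holds h11

/-- **Cerf 2015, Theorem 1.3 for `d = 3` (`Λ(n^16)`) from Theorem 1.1 only.**
[cite: Cerf2015, Thm 1.3 (case d = 3, p. 4) and §10] -/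
theorem Cerf2015_thm_1_3_three_of_thm_1_1 (h11 : Cerf2015_thm_1_1_of_siteTheta_pos) :
    Cerf2015_thm_1_3_three :=
  Cerf2015_thm_1_3_three_of_facts Cerf2015_lem_7_1_holds Cerf2015_lem_10_1_holds h11

end CritPerc

end Literature.Probability.Percolation
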